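import Summits.BirchSwinnertonDyer.BirchSwinnertonDyer.Theorems.GenusKolyvaginAtTwoMinimalTwinBSDTwoEggAllImages
import Summits.BirchSwinnertonDyer.BirchSwinnertonDyer.Theorems.GenusKolyvaginAtTwoMinimalTwinBSDTwoIdLocusByName
import HarnessLib

/-!
# Route `GenusKolyvaginAtTwo`, crux U₂ `MinimalTwinBSDTwo` (stmt-BirchSwinnertonDyer-22985), LINE 23 «twin_swap»: U₂ OFF THE IDENTITY LOCUS
# IS «WALL + RANK-ZERO 2-CONVERSE + THE TWO 2-ADIC EXPONENTS», NO IMAGE HYPOTHESIS; U₂ BY NAME FROM THE IDENTITY-LOCUS RESIDUAL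

Seat `bsd-line-gk2-p3` g31 (PROVER seat 3/3, cell `bsd-f1-sign2`), `--supports stmt-BirchSwinnertonDyer-22985` (helper; closes nothing).  Sequel of
`…MinimalTwinBSDTwoEggAllImages` (§1–§4: the image-free silent-prime twin package and egg engine).  THEOREMS ONLY (no definition, no named fact,
no `sorry`); standard axioms.  **BSD is NOT proved by this file; U₂, the wall, the 2-converse and EXP± are NOT proved; no item is closed.**
Both theorems are CONDITIONAL on their displayed hypotheses (PRINT facts; S1 = the rank-zero `#Sel₂ = 1` wall — items 19095–19098 sliced;
CONV₀ = the rank-zero 2-converse — items 19218/19219 + the off-semistable residual, gk2-p3 g30 `Ledger.Line25.rankZeroTwoConverse_of_items_of_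
offSemistable`; EXP⁻_all = gk2-p2 g25's text (p776404 §1); EXP⁺_all = the image-free text of `…EggAllImages` §4 — the BSD₂ content, lossless).

* §5 **`bsdp_offIdentity_of_wall_of_converse_of_exponents_of_facts`** — `BSD₂(W)` for every non-CM globally minimal `W` with `r_an = 1`,
  `#Sel₂ = 2` and `(Δ_W < 0 ∨ MeetsEgg W)` (p776404 §1 on `Δ < 0`, `…EggAllImages` §4 on the egg); and
  **`minimalTwinBSDTwo_of_wall_of_converse_of_exponents_of_identityLocus_of_facts`** — `…Theses.GenusKolyvaginAtTwo.MinimalTwinBSDTwo` BY NAME from the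
  same + ONE residual `hId`, the IDENTITY LOCUS «`Δ_W > 0 ∧ ¬MeetsEgg W`» (at Tamagawa depth `0` with surjective 2-adic image this is item 32821
  `RankOneAtTwoBigImageIdLocus` mod GZK — gk2-p3 g29 `hTw0idSharp_iff_idLocus_of_GZK`; the rest is the two-transposition territory).  READING for the
  LINE 23 holder (v1.8 residual OFF′ = `Δ > 0 ∧ [ρ̄_{W,2} not onto ∨ (¬MeetsEgg ∧ …)]`): the «`ρ̄_{W,2}` not onto» disjunct is GONE — **the residual of
  LINE 23 beyond wall + converse + exponents + S_id is the identity locus alone.**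
* §6 **`minimalTwinBSDTwo_of_wall_of_converse_of_exponents_of_rankOneAtTwoBigImageIdLocus_of_offLocus_of_facts`** — the FULLY ITEMISED image-free
  ledger: U₂ BY NAME ⟸ S1 + CONV₀ + EXP⁻_all + EXP⁺_all + PRINT + **item 32821 `RankOneAtTwoBigImageIdLocus` BY NAME** (the route decl of
  `ByReductionTypeAtTwo`, via gk2-p3 g29/g30 `rankOneAtTwoBigImageIdLocus_iff_hTw0idSharp_of_GZK`) + ONE residual OFF″ := «`Δ_W > 0 ∧ ¬MeetsEgg W ∧
  ¬(ord₂ C(W) = 0 ∧ ∀ n, ρ̄_{W,2ⁿ} onto)`» (the identity locus at positive Tamagawa depth or with non-surjective 2-adic image — the two-transposition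
  territory).  OFF″ ⊊ the holder's OFF′ (v1.8): the «`Δ` square» egg curves are no longer residual.  Nothing here is progress on BSD.

References: [GrossZagier1986] V §2 (2.2); [Kramer1981] §2 Props. 3, 6; [MazurRubin2010] Prop. 3.3, Cor. 3.4 (i), Lemma 3.5; [Milne1972ArithmeticAV]
§1 Thm. 1; [McCallumLMS1991] §5 Lemma 5.1; [Miller2011LMS] Def. 1.1.
-/

set_option autoImplicit false
set_option linter.dupNamespace false -- `Summit.<P>.<Sub>` repeats `BirchSwinnertonDyer` (D-0017)

noncomputable section

open scoped Classical

open WeierstrassCurve NumberField Literature.NumberTheory.EllipticCurves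
  Literature.NumberTheory.EllipticCurves.ModularForms
  Literature.NumberTheory.EllipticCurves.Rank1Residual
  Literature.NumberTheory.QuadraticFields
  Summit.BirchSwinnertonDyer.Rank1Residual
  Summit.BirchSwinnertonDyer.Rank1Residual.AdditivePotMult
  Summit.BirchSwinnertonDyer.Rank1Residual.F1Sign2
  Summit.BirchSwinnertonDyer.BirchSwinnertonDyer.Rank1Residual
  Summit.BirchSwinnertonDyer.BirchSwinnertonDyer.Theorems
  Summit.BirchSwinnertonDyer.BirchSwinnertonDyer.Theorems.GenusExact.TwinSwap

open Summit.BirchSwinnertonDyer.BirchSwinnertonDyer.Theorems.GenusExact.TwinSwap.AllDepth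
  (bsdp_negDisc_of_wall_of_converse_of_exponent_of_facts)
open Summit.BirchSwinnertonDyer.BirchSwinnertonDyer.Theorems.GenusExact.TwinSwap.Ledger.Line25
  (rankOneAtTwoBigImageIdLocus_iff_hTw0idSharp_of_GZK)
open Summit.BirchSwinnertonDyer.BirchSwinnertonDyer.Theses.ByReductionTypeAtTwo (RankOneAtTwoBigImageIdLocus)

namespace Summit.BirchSwinnertonDyer.BirchSwinnertonDyer.Theorems.GenusExact.TwinSwap.EggAllImages

/-! ## §5 U₂ off the identity locus; U₂ by name from the identity-locus residual -/

/-- **U₂ OFF THE IDENTITY LOCUS — wall + converse + the two exponents, NO image hypothesis, NO Tamagawa cell.**  For every non-CM globally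
minimal `W` with `r_an = 1`, `#Sel₂ = 2` and `(Δ_W < 0 ∨ MeetsEgg W)`: `BSD₂(W)`, from S1 + CONV₀ + EXP⁻_all (gk2-p2's text, p776404 §1) + EXP⁺_all
(§4's image-free text) + PRINT.  CONDITIONAL on the displayed hypotheses; proves nothing about BSD; closes nothing.
[cite: GrossZagier1986, V.§2 (2.2)] [cite: Kramer1981, §2 Props. 3, 6] [cite: MazurRubin2010, Prop. 3.3, Cor. 3.4 (i), Lemma 3.5] -/
theorem bsdp_offIdentity_of_wall_of_converse_of_exponents_of_facts
    (hGZ : ∀ (N : ℕ) [NeZero N] (W : WeierstrassCurve ℚ) (K : Type) [Field K] [NumberField K], gross_zagier N W K)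
    (hGZK : rank_eq_analyticRank_of_analyticRank_le_one) (hmod : hasEntireLFunction_rat)
    (hMilneC : Milne1972.bsdQuotient_baseChange_quadratic_anyModel) (hMP : nonempty_modularParametrizationData)
    (hS1 : ∀ (W : WeierstrassCurve ℚ) [W.IsElliptic] [W.IsGloballyMinimal],
      ¬ W.HasCM → W.analyticRank = 0 → Nat.card (W.selmerGroup 2) = 1 → BSDp W 2)
    (hC0 : ∀ (V : WeierstrassCurve ℚ) [V.IsElliptic] [V.IsGloballyMinimal], ¬ V.HasCM → V.selmerCorank 2 = 0 → V.analyticRank = 0)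
    (hEXPneg : ∀ (W : WeierstrassCurve ℚ) [W.IsElliptic] [W.IsGloballyMinimal] [NeZero (W.conductorNorm ℤ)],
      ¬ W.HasCM → W.analyticRank = 1 → Nat.card (W.selmerGroup 2) = 2 → W.Δ < 0 →
      ∀ (K : Type) [Field K] [NumberField K], IsImaginaryQuadratic K →
        ∀ (ℓ : ℕ) [Fact ℓ.Prime], NumberField.discr K = -(ℓ : ℤ) → ¬ W.selmerGroup 2 ≤ MazurRubin2010.strictLocalKer W ℚ_[ℓ] 2 →
        Odd (NumberField.discr K) → NumberField.discr K ≠ -3 → SatisfiesHeegnerHypothesis (W.conductorNorm ℤ) K →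
        ((Ideal.span {(2 : ℤ)}).primesOver (𝓞 K)).ncard = 2 →
        (W.quadraticTwist (NumberField.discr K : ℚ)).entireLFunction 1 ≠ 0 →
        ∀ (Dt : ModularParametrizationData W (W.conductorNorm ℤ)) (β : ℤ) (ι : K →+* ℂ) (d₁ : KolyvaginHeegnerData Dt β ι 1),
          (∃ Q : (W.baseChange (ringClassField K ι 1)).toAffine.Point,
            ((2 ^ (padicValInt 2 Dt.c + padicValNat 2 W.tamagawaProduct) : ℕ) : ℤ) • Q = d₁.derivedPoint) ∧
          (¬ ∃ Q : (W.baseChange (ringClassField K ι 1)).toAffine.Point,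
            ((2 ^ (padicValInt 2 Dt.c + padicValNat 2 W.tamagawaProduct + 1) : ℕ) : ℤ) • Q = d₁.derivedPoint))
    (hEXPpos : ∀ (W : WeierstrassCurve ℚ) [W.IsElliptic] [W.IsGloballyMinimal] [NeZero (W.conductorNorm ℤ)],
      ¬ W.HasCM → W.analyticRank = 1 → Nat.card (W.selmerGroup 2) = 2 → 0 < W.Δ → MeetsEgg W →
      ∀ (K : Type) [Field K] [NumberField K], IsImaginaryQuadratic K →
        ∀ (ℓ : ℕ), ℓ.Prime → NumberField.discr K = -(ℓ : ℤ) →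
        (∀ x : ZMod ℓ, 4 * x ^ 3 + ((integralModelInt W).b₂ : ZMod ℓ) * x ^ 2 +
            2 * ((integralModelInt W).b₄ : ZMod ℓ) * x + ((integralModelInt W).b₆ : ZMod ℓ) ≠ 0) →
        Odd (NumberField.discr K) → NumberField.discr K ≠ -3 → SatisfiesHeegnerHypothesis (W.conductorNorm ℤ) K →
        (W.quadraticTwist (NumberField.discr K : ℚ)).entireLFunction 1 ≠ 0 →
        ∀ (Dt : ModularParametrizationData W (W.conductorNorm ℤ)) (β : ℤ) (ι : K →+* ℂ) (d₁ : KolyvaginHeegnerData Dt β ι 1),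
          (∃ Q : (W.baseChange (ringClassField K ι 1)).toAffine.Point,
            ((2 ^ (padicValInt 2 Dt.c + padicValNat 2 W.tamagawaProduct) : ℕ) : ℤ) • Q = d₁.derivedPoint) ∧
          (¬ ∃ Q : (W.baseChange (ringClassField K ι 1)).toAffine.Point,
            ((2 ^ (padicValInt 2 Dt.c + padicValNat 2 W.tamagawaProduct + 1) : ℕ) : ℤ) • Q = d₁.derivedPoint)) :
    ∀ (W : WeierstrassCurve ℚ) [W.IsElliptic] [W.IsGloballyMinimal], ¬ W.HasCM → W.analyticRank = 1 →
      Nat.card (W.selmerGroup 2) = 2 → (W.Δ < 0 ∨ MeetsEgg W) → BSDp W 2 := by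
  intro W _ _ hcm hr hSel hcell
  rcases lt_trichotomy W.Δ 0 with hΔ | hΔ | hΔ
  · exact bsdp_negDisc_of_wall_of_converse_of_exponent_of_facts hGZ hGZK hmod hMilneC hMP hS1 hC0 hEXPneg W hcm hr hSel hΔ
  · exact absurd hΔ W.isUnit_Δ.ne_zero
  · have hegg : MeetsEgg W := hcell.resolve_left (not_lt.mpr hΔ.le)
    exact bsdp_posDisc_egg_of_wall_of_converse_of_exponent_of_facts_allImages hGZ hGZK hmod hMilneC hMP hS1 hC0 hEXPpos W hcm hr hSel
      hΔ hegg

/-- **U₂ `MinimalTwinBSDTwo` BY NAME from wall + converse + exponents + PRINT + ONE residual: THE IDENTITY LOCUS** `hId` («every non-CM globally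
minimal `W` with `r_an = 1`, `#Sel₂ = 2`, `Δ_W > 0` and `W(ℚ) ⊂ W⁰(ℝ)` satisfies `BSD₂`» — at Tamagawa depth `0` with surjective 2-adic image this
is item 32821 `RankOneAtTwoBigImageIdLocus` (mod GZK, gk2-p3 g29 `hTw0idSharp_iff_idLocus_of_GZK`); the rest is the two-transposition territory).
The «`ρ̄_{W,2}` not onto» disjunct of the holder's residual OFF′ (v1.8) is GONE.  CONDITIONAL on the displayed hypotheses; proves nothing about
BSD; closes nothing.  [cite: GrossZagier1986, V.§2 (2.2)] [cite: Kramer1981, §2 Props. 3, 6] [cite: MazurRubin2010, Cor. 3.4 (i)] -/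
theorem minimalTwinBSDTwo_of_wall_of_converse_of_exponents_of_identityLocus_of_facts
    (hGZ : ∀ (N : ℕ) [NeZero N] (W : WeierstrassCurve ℚ) (K : Type) [Field K] [NumberField K], gross_zagier N W K)
    (hGZK : rank_eq_analyticRank_of_analyticRank_le_one) (hmod : hasEntireLFunction_rat)
    (hMilneC : Milne1972.bsdQuotient_baseChange_quadratic_anyModel) (hMP : nonempty_modularParametrizationData)
    (hS1 : ∀ (W : WeierstrassCurve ℚ) [W.IsElliptic] [W.IsGloballyMinimal],
      ¬ W.HasCM → W.analyticRank = 0 → Nat.card (W.selmerGroup 2) = 1 → BSDp W 2)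
    (hC0 : ∀ (V : WeierstrassCurve ℚ) [V.IsElliptic] [V.IsGloballyMinimal], ¬ V.HasCM → V.selmerCorank 2 = 0 → V.analyticRank = 0)
    (hEXPneg : ∀ (W : WeierstrassCurve ℚ) [W.IsElliptic] [W.IsGloballyMinimal] [NeZero (W.conductorNorm ℤ)],
      ¬ W.HasCM → W.analyticRank = 1 → Nat.card (W.selmerGroup 2) = 2 → W.Δ < 0 →
      ∀ (K : Type) [Field K] [NumberField K], IsImaginaryQuadratic K →
        ∀ (ℓ : ℕ) [Fact ℓ.Prime], NumberField.discr K = -(ℓ : ℤ) → ¬ W.selmerGroup 2 ≤ MazurRubin2010.strictLocalKer W ℚ_[ℓ] 2 →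
        Odd (NumberField.discr K) → NumberField.discr K ≠ -3 → SatisfiesHeegnerHypothesis (W.conductorNorm ℤ) K →
        ((Ideal.span {(2 : ℤ)}).primesOver (𝓞 K)).ncard = 2 →
        (W.quadraticTwist (NumberField.discr K : ℚ)).entireLFunction 1 ≠ 0 →
        ∀ (Dt : ModularParametrizationData W (W.conductorNorm ℤ)) (β : ℤ) (ι : K →+* ℂ) (d₁ : KolyvaginHeegnerData Dt β ι 1),
          (∃ Q : (W.baseChange (ringClassField K ι 1)).toAffine.Point,
            ((2 ^ (padicValInt 2 Dt.c + padicValNat 2 W.tamagawaProduct) : ℕ) : ℤ) • Q = d₁.derivedPoint) ∧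
          (¬ ∃ Q : (W.baseChange (ringClassField K ι 1)).toAffine.Point,
            ((2 ^ (padicValInt 2 Dt.c + padicValNat 2 W.tamagawaProduct + 1) : ℕ) : ℤ) • Q = d₁.derivedPoint))
    (hEXPpos : ∀ (W : WeierstrassCurve ℚ) [W.IsElliptic] [W.IsGloballyMinimal] [NeZero (W.conductorNorm ℤ)],
      ¬ W.HasCM → W.analyticRank = 1 → Nat.card (W.selmerGroup 2) = 2 → 0 < W.Δ → MeetsEgg W →
      ∀ (K : Type) [Field K] [NumberField K], IsImaginaryQuadratic K →
        ∀ (ℓ : ℕ), ℓ.Prime → NumberField.discr K = -(ℓ : ℤ) →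
        (∀ x : ZMod ℓ, 4 * x ^ 3 + ((integralModelInt W).b₂ : ZMod ℓ) * x ^ 2 +
            2 * ((integralModelInt W).b₄ : ZMod ℓ) * x + ((integralModelInt W).b₆ : ZMod ℓ) ≠ 0) →
        Odd (NumberField.discr K) → NumberField.discr K ≠ -3 → SatisfiesHeegnerHypothesis (W.conductorNorm ℤ) K →
        (W.quadraticTwist (NumberField.discr K : ℚ)).entireLFunction 1 ≠ 0 →
        ∀ (Dt : ModularParametrizationData W (W.conductorNorm ℤ)) (β : ℤ) (ι : K →+* ℂ) (d₁ : KolyvaginHeegnerData Dt β ι 1),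
          (∃ Q : (W.baseChange (ringClassField K ι 1)).toAffine.Point,
            ((2 ^ (padicValInt 2 Dt.c + padicValNat 2 W.tamagawaProduct) : ℕ) : ℤ) • Q = d₁.derivedPoint) ∧
          (¬ ∃ Q : (W.baseChange (ringClassField K ι 1)).toAffine.Point,
            ((2 ^ (padicValInt 2 Dt.c + padicValNat 2 W.tamagawaProduct + 1) : ℕ) : ℤ) • Q = d₁.derivedPoint))
    (hId : ∀ (W : WeierstrassCurve ℚ) [W.IsElliptic] [W.IsGloballyMinimal], ¬ W.HasCM → W.analyticRank = 1 →
      Nat.card (W.selmerGroup 2) = 2 → 0 < W.Δ → ¬ MeetsEgg W → BSDp W 2) :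
    Summit.BirchSwinnertonDyer.BirchSwinnertonDyer.Theses.GenusKolyvaginAtTwo.MinimalTwinBSDTwo := by
  intro W _ _ hcm hr hSel
  by_cases hcell : W.Δ < 0 ∨ MeetsEgg W
  · exact bsdp_offIdentity_of_wall_of_converse_of_exponents_of_facts hGZ hGZK hmod hMilneC hMP hS1 hC0 hEXPneg hEXPpos W hcm hr hSel hcell
  · push Not at hcell
    have hΔ : 0 < W.Δ := lt_of_le_of_ne hcell.1 (Ne.symm W.isUnit_Δ.ne_zero)
    exact hId W hcm hr hSel hΔ hcell.2

/-! ## §6 The fully itemised image-free ledger: item 32821 by name + the residual OFF″ -/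

/-- **U₂ `MinimalTwinBSDTwo` BY NAME — FULLY ITEMISED, IMAGE-FREE.**  From S1 (wall) + CONV₀ + EXP⁻_all + EXP⁺_all + PRINT + **item 32821
`RankOneAtTwoBigImageIdLocus` BY NAME** (the identity locus at Tamagawa depth `0` with surjective 2-adic image, mod GZK) + ONE residual `hOff` = OFF″ :=
«every non-CM globally minimal `W` with `r_an = 1`, `#Sel₂ = 2`, `Δ_W > 0`, `W(ℚ) ⊂ W⁰(ℝ)` and NOT (`ord₂ C(W) = 0` and `ρ̄_{W,2ⁿ}` onto for all `n`)
satisfies `BSD₂`» (the two-transposition territory).  OFF″ is the holder's v1.8 residual OFF′ WITHOUT its «`ρ̄_{W,2}` not onto» egg disjunct.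
CONDITIONAL on the displayed hypotheses; proves nothing about BSD; closes nothing.
[cite: GrossZagier1986, V.§2 (2.2)] [cite: Kramer1981, §2 Props. 3, 6] [cite: MazurRubin2010, Cor. 3.4 (i)] [cite: SilvermanAEC2009, X.4.2] -/
theorem minimalTwinBSDTwo_of_wall_of_converse_of_exponents_of_rankOneAtTwoBigImageIdLocus_of_offLocus_of_facts
    (hGZ : ∀ (N : ℕ) [NeZero N] (W : WeierstrassCurve ℚ) (K : Type) [Field K] [NumberField K], gross_zagier N W K)
    (hGZK : rank_eq_analyticRank_of_analyticRank_le_one) (hmod : hasEntireLFunction_rat)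
    (hMilneC : Milne1972.bsdQuotient_baseChange_quadratic_anyModel) (hMP : nonempty_modularParametrizationData)
    (hS1 : ∀ (W : WeierstrassCurve ℚ) [W.IsElliptic] [W.IsGloballyMinimal],
      ¬ W.HasCM → W.analyticRank = 0 → Nat.card (W.selmerGroup 2) = 1 → BSDp W 2)
    (hC0 : ∀ (V : WeierstrassCurve ℚ) [V.IsElliptic] [V.IsGloballyMinimal], ¬ V.HasCM → V.selmerCorank 2 = 0 → V.analyticRank = 0)
    (hEXPneg : ∀ (W : WeierstrassCurve ℚ) [W.IsElliptic] [W.IsGloballyMinimal] [NeZero (W.conductorNorm ℤ)],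
      ¬ W.HasCM → W.analyticRank = 1 → Nat.card (W.selmerGroup 2) = 2 → W.Δ < 0 →
      ∀ (K : Type) [Field K] [NumberField K], IsImaginaryQuadratic K →
        ∀ (ℓ : ℕ) [Fact ℓ.Prime], NumberField.discr K = -(ℓ : ℤ) → ¬ W.selmerGroup 2 ≤ MazurRubin2010.strictLocalKer W ℚ_[ℓ] 2 →
        Odd (NumberField.discr K) → NumberField.discr K ≠ -3 → SatisfiesHeegnerHypothesis (W.conductorNorm ℤ) K →
        ((Ideal.span {(2 : ℤ)}).primesOver (𝓞 K)).ncard = 2 →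
        (W.quadraticTwist (NumberField.discr K : ℚ)).entireLFunction 1 ≠ 0 →
        ∀ (Dt : ModularParametrizationData W (W.conductorNorm ℤ)) (β : ℤ) (ι : K →+* ℂ) (d₁ : KolyvaginHeegnerData Dt β ι 1),
          (∃ Q : (W.baseChange (ringClassField K ι 1)).toAffine.Point,
            ((2 ^ (padicValInt 2 Dt.c + padicValNat 2 W.tamagawaProduct) : ℕ) : ℤ) • Q = d₁.derivedPoint) ∧
          (¬ ∃ Q : (W.baseChange (ringClassField K ι 1)).toAffine.Point,
            ((2 ^ (padicValInt 2 Dt.c + padicValNat 2 W.tamagawaProduct + 1) : ℕ) : ℤ) • Q = d₁.derivedPoint))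
    (hEXPpos : ∀ (W : WeierstrassCurve ℚ) [W.IsElliptic] [W.IsGloballyMinimal] [NeZero (W.conductorNorm ℤ)],
      ¬ W.HasCM → W.analyticRank = 1 → Nat.card (W.selmerGroup 2) = 2 → 0 < W.Δ → MeetsEgg W →
      ∀ (K : Type) [Field K] [NumberField K], IsImaginaryQuadratic K →
        ∀ (ℓ : ℕ), ℓ.Prime → NumberField.discr K = -(ℓ : ℤ) →
        (∀ x : ZMod ℓ, 4 * x ^ 3 + ((integralModelInt W).b₂ : ZMod ℓ) * x ^ 2 +
            2 * ((integralModelInt W).b₄ : ZMod ℓ) * x + ((integralModelInt W).b₆ : ZMod ℓ) ≠ 0) →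
        Odd (NumberField.discr K) → NumberField.discr K ≠ -3 → SatisfiesHeegnerHypothesis (W.conductorNorm ℤ) K →
        (W.quadraticTwist (NumberField.discr K : ℚ)).entireLFunction 1 ≠ 0 →
        ∀ (Dt : ModularParametrizationData W (W.conductorNorm ℤ)) (β : ℤ) (ι : K →+* ℂ) (d₁ : KolyvaginHeegnerData Dt β ι 1),
          (∃ Q : (W.baseChange (ringClassField K ι 1)).toAffine.Point,
            ((2 ^ (padicValInt 2 Dt.c + padicValNat 2 W.tamagawaProduct) : ℕ) : ℤ) • Q = d₁.derivedPoint) ∧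
          (¬ ∃ Q : (W.baseChange (ringClassField K ι 1)).toAffine.Point,
            ((2 ^ (padicValInt 2 Dt.c + padicValNat 2 W.tamagawaProduct + 1) : ℕ) : ℤ) • Q = d₁.derivedPoint))
    (hSid : RankOneAtTwoBigImageIdLocus)
    (hOff : ∀ (W : WeierstrassCurve ℚ) [W.IsElliptic] [W.IsGloballyMinimal], ¬ W.HasCM → W.analyticRank = 1 →
      Nat.card (W.selmerGroup 2) = 2 → 0 < W.Δ → ¬ MeetsEgg W →
      ¬ (padicValNat 2 W.tamagawaProduct = 0 ∧ ∀ n : ℕ, W.HasSurjectiveModNGaloisRep ((2 ^ n : ℕ) : ℤ)) → BSDp W 2) :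
    Summit.BirchSwinnertonDyer.BirchSwinnertonDyer.Theses.GenusKolyvaginAtTwo.MinimalTwinBSDTwo := by
  refine minimalTwinBSDTwo_of_wall_of_converse_of_exponents_of_identityLocus_of_facts hGZ hGZK hmod hMilneC hMP hS1 hC0 hEXPneg hEXPpos ?_
  intro W _ _ hcm hr hSel hΔ hegg
  by_cases h : padicValNat 2 W.tamagawaProduct = 0 ∧ ∀ n : ℕ, W.HasSurjectiveModNGaloisRep ((2 ^ n : ℕ) : ℤ)
  · exact (rankOneAtTwoBigImageIdLocus_iff_hTw0idSharp_of_GZK hGZK).mp hSid W hcm hr hSel h.2 hΔ h.1 hegg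
  · exact hOff W hcm hr hSel hΔ hegg h

end Summit.BirchSwinnertonDyer.BirchSwinnertonDyer.Theorems.GenusExact.TwinSwap.EggAllImages

end
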